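import Summits.AnomalousDissipation.AnomalousDissipation.Theorems.SolenoidalFractalHomogenisationLagrangianStepCellLawVSectorialOn
import Summits.AnomalousDissipation.AnomalousDissipation.Theorems.SolenoidalFractalHomogenisationLagrangianStepCellClauseCutsFamily
import Summits.AnomalousDissipation.AnomalousDissipation.Theorems.SolenoidalFractalHomogenisationLagrangianStepCellLawVQSPinch
import Summits.AnomalousDissipation.AnomalousDissipation.Theorems.SolenoidalFractalHomogenisationLagrangianStepCellLawVDesignPoint
import HarnessLib

/-!
# K1L_D `stub_cellLawV0_IS` — the (W)-CROSSING CERTIFICATE for the exact ν-dependent effective map (service D1; planner ad-ideate-p5 g11, lens «profile»)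

Registry of record v9 (`HOME/ad-ideate-p1/r25/v9/onelevel_design_v9.lean`, 9e65391f7fed72e5; stub text byte-identical to v8 l.335; registry note «stub_cellLawV0_IS (V0: w1 g4 S1a / IS: —)» = the interval-sectorial half is UNOWNED), open stub `stub_cellLawV0_IS`:
`ScalarLawBlock … → ∃ M hM c Φ μ Sstar slo shi lam₀ Λ Λc Λ' τlo τhi τc, ∃ lo>0, ∃ hi, lo ≤ 1 ∧ 1 ≤ hi ∧ ∃ ΛV>1, ∃ β≥0,
SectorialIntervalWindowFamily Φ μ Sstar slo shi lam₀ Λ Λc Λ' τlo τhi τc β lo hi ΛV ∧ ∃ σ>0 C≥0 ν₀>0 K>0, SlowVectorClauseNoExF cubatureWord M hM c Φ lo hi ΛV β σ C ν₀ K`.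
Its (V) half (`SlowVectorClauseNoExF`, the linear-response error of the EXACT family `Φ ν`) is w1 g4's S1a/V0; the (W) half for the SAME exact family is
the subject of this file (w1 g3 DONE 20:52:25Z named it D1: "the (W)-crossing certificate for the exact Φν ≠ Φ_QS").

## What is typed here (sorry-free except the two named stubs `stub_W_evenSlackB`, `stub_D1_exactFamily` of §5)
* §1 `RelSmall R A ρ` — the scale-free RESIDUE CURRENCY `bsymb R(k;p,q)² ≤ ρ²·symb A(k,p)·symb A(k,q)` on transverse pairs, and its two perturbation
  lemmas: EVEN `InInterval S⋆ λ' A → RelSmall R A ρ → InInterval S⋆ (λ'/(1-ρ)) (A+R)`; ODD `OddSectorial A τ → RelSmall R A ρ → OddSectorial (A+R) ((τ+2ρ)/(1-ρ))`.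
* §2 ODD CROSSING: `SectorialOddChannelBoundOn Φ₀ … κ ε τ₀` + residue `ρ` ⟹ `SectorialOddChannelBoundOn Φ … (κ/(1-ρ)) ((ε+2ρ)/(1-ρ)) τ₀`.
* §3 EVEN CROSSING: the design map's even clause WITH SLACK `δ` (`… → InInterval S⋆ (λ/(1+δ)) (Φ₀ S)`) + residue `ρ` with `1 ≤ (1-ρ)(1+δ)` ⟹ the even half
  for `Φ` with defect `μ = 1` — so the defect family COLLAPSES to `μ ≡ 1` (`TailDefectBound` by the landed `tailDefectBound_one`).
* §4 `windowFamily_of_WCrossing` : closed-form window-with-slack + ν-UNIFORM residue bound + bookkeeping ⟹ `SectorialIntervalWindowFamily Φ (fun _ => 1) …`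
  (via the landed `sectorialIntervalWindowClause_of_channelBoundOn_of_gain_lt_one`), and `cellLawV0_IS_statement_of_WCrossing` : … + the (V) clause ⟹ the
  ∃-conclusion of `stub_cellLawV0_IS` VERBATIM (witnesses `μ := 1`, `Λ' := Λ`, `lo := slo/Λc`, `hi := shi·Λc`, `τc := τlo`, `β := τlo·shi·Λc`,
  `τhi := τlo·ΛV·Λc·(shi·Λc)/(slo/Λc)`).
* §5 the two remaining OBLIGATIONS, parametrised by design map `Φ₀` and budget `ρ` (`ClosedFormWindowB Φ₀ ρ`, `D1ExactFamily Φ₀ ρ M hM`), the PROVED reduction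
  `cellLawV0_IS_statement_of_D1`, and at the branch-B instance `Φ₀ := ΦB a = a • excQS cubatureWord MB` (MB = 1/50, ρB = 1.2·10⁻⁴): the ODD conjunct DISCHARGED by
  the landed design point (`oddChannelOn_ΦB`, κ = 93/100, ε = 0, any `a`), the even-only stub `stub_W_evenSlackB : ∃ a > 0, EvenSlackWindowB a ρB`, the D1 stub
  `stub_D1_exactFamily`, and `stub_cellLawV0_IS_of_D1` = the registered stub text from the two stubs.

## DESIGN FINDING (profile, numbers of record: kit j319175 / j319221 closed form, j319226 / j319254 full Leray–Galerkin dynamics; memo `Lines/onelevel-W-crossing.md`)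
At the branch-B point (profile at `T₀ = 4π²·M·40 = 30.0/30.4/31.6`, `M = 0.019 / 1/52 / 1/50`; odd design point κ = 0.93 on `NearIso(10/11, 11/10)`, τ ≤ 1/5, `M ≥ 1/50`, `…CellLawVDesignPoint` p661274):
(F1) `TailDefectBound` forces `∏ μ(ν_i) ≤ Λc/λ₀`, so every ν-INDEPENDENT piece of `Φ ν` (the quasi-static `excQS`, the pair-memory term `pairQS`) must sit
inside an EXACTLY interval-preserving design map; only ν-dependent debris may carry a defect — and (F3) shows there is none to speak of: `μ ≡ 1`.
(F2) An order-reversing degree-(−1) map has ZERO radial margin; the only slack is subhomogeneity `D(λ) = (ϑ(T₀)−ϑ(T₀/λ))/ϑ(T₀) ≈ 12(λ²−1)/T₀²`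
(1.17e-3 at λ = 1.05).  I-CENTRED (`S⋆ = isoVisc`): the exact functional-calculus sandwich (all symmetric inputs) FAILS for λ < 1.10 (anisotropy of
`excQS(I)`, aspect−1 = 1.06e-3 ≈ D(1.05); = g6 threshold a⋆ = λ⋆² = 1.2123) — incompatible with the block window `Λ·shi ≤ 11/10`.  EIGEN-CENTRED
(`S⋆` = Perron eigen-shape of `excQS`, power iteration, 14 steps): realised slack on the binding families (interval end faces, sectorial inputs)
≈ 5.0·10⁻³(λ−1) + 1.5·10⁻⁵ − 0.09·τ² (j319319 ledger: +1.897e-4 at λ = 1.04, τ = 0.02; +2.40e-4 at λ = 1.05; tilts / random psd faces 5–15× more); the exact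
I-centred criterion turns positive only at λ ≈ 1.106 ⇒ `τ₀(even) ≲ 0.02–0.03` (NOT 1/5), `λ₀ ≳ 1.04`, and by the aspect bookkeeping `ΛV·Λc·shi/slo ≤ Λ ≤ 1.1/shi` ⇒ ΛV ≲ 1.055.
(F3) The residue of the EXACT cell dynamics against `excQS + pairQS` at T₀ = 30 is ≤ 3·10⁻¹⁰ (j319254: 171 cases, 7 input shapes × 4 directions × ν ∈ {4,2,1}·10⁻³ ×
Galerkin kmax 1,2; the 2·10⁻⁶…10⁻⁸ values at step h = 1.25 are RK4 error — h = 0.625 gives 1.3·10⁻¹⁰ / 6.8·10⁻¹⁰; finite-ϖ part 6.7·10⁻⁵·ϖ² belongs to (V)):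
in the ϖ → 0 limit the only ν-dependence is debris that must cross a full foreign slot, damped by `exp(−T₀·slo) ≈ 1e-12`; the pair term itself is 6e-5–1e-4
(seen by the dynamics: residue WITHOUT it = 6.5e-5) and even (odd part 1e-20 on symmetric inputs).  Hence D1's (W) obligation `ResidueOnWindow` holds with
`ρ = 10⁻⁵` once `pairQS` is put into the design map (variant B), or with `ρB = 1.2·10⁻⁴` if `Φ₀ = a·excQS` alone (variant A, the stubs below) — either way it FITS
the eigen-centred slack (1.9·10⁻⁴ at λ₀ = 1.04, τ₀ = 0.02), and the binding constraint of the even half is the CLOSED-FORM eigen-centred clause, not the exactness of `Φ ν`.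

Planner sketch for the crux owner / `stub_cellLawV0_IS` provers; NOT a proof of the stub, of K1L_D, of Onsager's conjecture or of anomalous dissipation.
-/

set_option linter.dupNamespace false
set_option linter.unusedVariables false

namespace Summit.AnomalousDissipation.AnomalousDissipation.Cruxes.LagrangianRenormalisationStep.WCrossing

open Summit.AnomalousDissipation.AnomalousDissipation.Theorems
open Summit.AnomalousDissipation.AnomalousDissipation.Theorems.SolenoidalFractalHomogenisation.LagrangianStep
open Literature.Analysis Literature.Analysis.FluidPDE Literature.Analysis.FunctionSpaces
open Set

noncomputable section

/-! ## §1 The residue currency and its two perturbation lemmas -/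

/-- `R` is `ρ`-SMALL RELATIVE TO `A`: `bsymb R(k;p,q)² ≤ ρ² · symb A(k,p) · symb A(k,q)` for all transverse `p, q ⊥ k` (scale-free; covers the diagonal
`symb R ≤ ρ·symb A` and the cross/odd entries in geometric-mean form). -/
def RelSmall (R A : T4) (ρ : ℝ) : Prop :=
  ∀ k p q : Fin 3 → ℝ, ∑ i, p i * k i = 0 → ∑ i, q i * k i = 0 →
    (Torus.bsymb R k p q) ^ 2 ≤ ρ ^ 2 * (Torus.symb A k p * Torus.symb A k q)

/-- Diagonal consequence: `|symb R(k,p)| ≤ ρ·symb A(k,p)`. [folklore] -/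
theorem RelSmall.symb_abs_le {R A : T4} {ρ : ℝ} (h : RelSmall R A ρ) (hA : TransNonneg A) (hρ : 0 ≤ ρ)
    (k p : Fin 3 → ℝ) (hkp : ∑ i, p i * k i = 0) : |Torus.symb R k p| ≤ ρ * Torus.symb A k p := by
  have h1 := h k p p hkp hkp
  rw [← Torus.symb_eq_bsymb] at h1
  have hnn : 0 ≤ ρ * Torus.symb A k p := mul_nonneg hρ (hA k p hkp)
  have h2 : (Torus.symb R k p) ^ 2 ≤ (ρ * Torus.symb A k p) ^ 2 := by nlinarith [h1]
  exact abs_le_of_sq_le_sq' h2 hnn |>.elim (fun h₁ h₂ => abs_le.mpr ⟨h₁, h₂⟩)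

/-- Two-sided radial comparison `(1-ρ)·A ≼ A + R ≼ (1+ρ)·A`. [folklore] -/
theorem RelSmall.transLE {R A : T4} {ρ : ℝ} (h : RelSmall R A ρ) (hA : TransNonneg A) (hρ : 0 ≤ ρ) :
    TransLE ((1 - ρ) • A) (A + R) ∧ TransLE (A + R) ((1 + ρ) • A) := by
  constructor
  · intro k p hkp
    have := abs_le.mp (h.symb_abs_le hA hρ k p hkp)
    rw [Torus.symb_smul, Torus.symb_add]; linarith [this.1]
  · intro k p hkp
    have := abs_le.mp (h.symb_abs_le hA hρ k p hkp)
    rw [Torus.symb_smul, Torus.symb_add]; linarith [this.2]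

/-- Positivity of a tensor inside an order interval about a nonnegative centre. [folklore] -/
theorem transNonneg_of_inInterval {Sstar A : T4} {lam : ℝ} (h : InInterval Sstar lam A) (hstar : TransNonneg Sstar) (hlam : 0 < lam) :
    TransNonneg A := by
  intro k p hkp
  have h1 := h.1 k p hkp
  rw [Torus.symb_smul] at h1
  exact le_trans (mul_nonneg (by positivity) (hstar k p hkp)) h1

/-- **EVEN perturbation lemma.**  `S⋆/λ' ≼ A ≼ λ' S⋆` and `R` `ρ`-small relative to `A` (`ρ < 1`) give `A + R` in the interval of aspect `λ'/(1-ρ)`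
(uses `1 + ρ ≤ 1/(1-ρ)`). [folklore] -/
theorem inInterval_add_of_relSmall {Sstar A R : T4} {lam ρ : ℝ} (h : InInterval Sstar lam A) (hR : RelSmall R A ρ)
    (hstar : TransNonneg Sstar) (hρ : 0 ≤ ρ) (hρ1 : ρ < 1) (hlam : 0 < lam) :
    InInterval Sstar (lam / (1 - ρ)) (A + R) := by
  have hA : TransNonneg A := transNonneg_of_inInterval h hstar hlam
  obtain ⟨hlo, hhi⟩ := hR.transLE hA hρ
  have h1ρ : 0 < 1 - ρ := by linarith
  constructor
  · intro k p hkp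
    have ha := h.1 k p hkp
    have hb := hlo k p hkp
    rw [Torus.symb_smul] at ha hb ⊢
    have hs := hstar k p hkp
    -- (1/(lam/(1-ρ))) s = ((1-ρ)/lam) s ≤ (1-ρ) symb A ≤ symb (A+R)
    have : 1 / (lam / (1 - ρ)) * Torus.symb Sstar k p = (1 - ρ) * (1 / lam * Torus.symb Sstar k p) := by
      field_simp
    rw [this]
    exact le_trans (mul_le_mul_of_nonneg_left ha h1ρ.le) hb
  · intro k p hkp
    have ha := h.2 k p hkp
    have hb := hhi k p hkp
    rw [Torus.symb_smul] at ha hb ⊢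
    have hs := hstar k p hkp
    have hAp := hA k p hkp
    -- symb (A+R) ≤ (1+ρ) symb A ≤ (1+ρ) lam s ≤ lam/(1-ρ) s
    have h3 : (1 + ρ) * (lam * Torus.symb Sstar k p) ≤ lam / (1 - ρ) * Torus.symb Sstar k p := by
      have h4 : (1 + ρ) ≤ 1 / (1 - ρ) := by
        rw [le_div_iff₀ h1ρ]; nlinarith
      have h5 : 0 ≤ lam * Torus.symb Sstar k p := mul_nonneg hlam.le hs
      calc (1 + ρ) * (lam * Torus.symb Sstar k p) ≤ (1 / (1 - ρ)) * (lam * Torus.symb Sstar k p) :=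
            mul_le_mul_of_nonneg_right h4 h5
        _ = lam / (1 - ρ) * Torus.symb Sstar k p := by ring
    exact le_trans hb (le_trans (mul_le_mul_of_nonneg_left ha (by linarith)) h3)

/-- **ODD perturbation lemma.**  `OddSectorial A τ` and `R` `ρ`-small relative to `A` (`ρ < 1`) give `OddSectorial (A + R) ((τ + 2ρ)/(1-ρ))`:
gain `1/(1-ρ)`, source `2ρ/(1-ρ)`. [folklore] -/
theorem oddSectorial_add_of_relSmall {A R : T4} {τ ρ : ℝ} (h : OddSectorial A τ) (hR : RelSmall R A ρ) (hA : TransNonneg A)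
    (hτ : 0 ≤ τ) (hρ : 0 ≤ ρ) (hρ1 : ρ < 1) : OddSectorial (A + R) ((τ + 2 * ρ) / (1 - ρ)) := by
  intro k p q hp hq
  have h1ρ : 0 < 1 - ρ := by linarith
  set a := Torus.symb A k p with ha_def
  set b := Torus.symb A k q with hb_def
  have ha : 0 ≤ a := hA k p hp
  have hb : 0 ≤ b := hA k q hq
  set s := Real.sqrt (a * b) with hs_def
  have hs : 0 ≤ s := Real.sqrt_nonneg _
  have hs2 : s ^ 2 = a * b := Real.sq_sqrt (mul_nonneg ha hb)
  -- the three small quantities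
  have hx : |Torus.bsymb A k p q - Torus.bsymb A k q p| ≤ τ * s := by
    refine abs_le_of_sq_le_sq' ?_ (mul_nonneg hτ hs) |>.elim (fun h₁ h₂ => abs_le.mpr ⟨h₁, h₂⟩)
    rw [mul_pow, hs2]; exact h k p q hp hq
  have hr1 : |Torus.bsymb R k p q| ≤ ρ * s := by
    refine abs_le_of_sq_le_sq' ?_ (mul_nonneg hρ hs) |>.elim (fun h₁ h₂ => abs_le.mpr ⟨h₁, h₂⟩)
    rw [mul_pow, hs2]; exact hR k p q hp hq
  have hr2 : |Torus.bsymb R k q p| ≤ ρ * s := by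
    refine abs_le_of_sq_le_sq' ?_ (mul_nonneg hρ hs) |>.elim (fun h₁ h₂ => abs_le.mpr ⟨h₁, h₂⟩)
    rw [mul_pow, hs2, mul_comm a b]; exact hR k q p hq hp
  -- odd part of A + R
  have hsum : Torus.bsymb (A + R) k p q - Torus.bsymb (A + R) k q p
      = (Torus.bsymb A k p q - Torus.bsymb A k q p) + Torus.bsymb R k p q - Torus.bsymb R k q p := by
    rw [Torus.bsymb_add, Torus.bsymb_add]; ring
  have hodd : |Torus.bsymb (A + R) k p q - Torus.bsymb (A + R) k q p| ≤ (τ + 2 * ρ) * s := by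
    rw [hsum]
    calc |(Torus.bsymb A k p q - Torus.bsymb A k q p) + Torus.bsymb R k p q - Torus.bsymb R k q p|
        ≤ |(Torus.bsymb A k p q - Torus.bsymb A k q p) + Torus.bsymb R k p q| + |Torus.bsymb R k q p| := abs_sub _ _
      _ ≤ |Torus.bsymb A k p q - Torus.bsymb A k q p| + |Torus.bsymb R k p q| + |Torus.bsymb R k q p| := by
          gcongr; exact abs_add_le _ _
      _ ≤ τ * s + ρ * s + ρ * s := by gcongr
      _ = (τ + 2 * ρ) * s := by ring
  -- even parts of A + R dominate (1-ρ)·a, (1-ρ)·b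
  obtain ⟨hlo, _⟩ := hR.transLE hA hρ
  have hpa : (1 - ρ) * a ≤ Torus.symb (A + R) k p := by have := hlo k p hp; rwa [Torus.symb_smul] at this
  have hqb : (1 - ρ) * b ≤ Torus.symb (A + R) k q := by have := hlo k q hq; rwa [Torus.symb_smul] at this
  have hc : 0 ≤ τ + 2 * ρ := by linarith
  -- square and compare
  have hsq : (Torus.bsymb (A + R) k p q - Torus.bsymb (A + R) k q p) ^ 2 ≤ ((τ + 2 * ρ) * s) ^ 2 := by
    have h0 : 0 ≤ (τ + 2 * ρ) * s := mul_nonneg hc hs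
    exact sq_le_sq' (by linarith [(abs_le.mp hodd).1]) (abs_le.mp hodd).2
  have hab : a * b ≤ (Torus.symb (A + R) k p / (1 - ρ)) * (Torus.symb (A + R) k q / (1 - ρ)) := by
    have h1 : a ≤ Torus.symb (A + R) k p / (1 - ρ) := by rw [le_div_iff₀ h1ρ]; linarith
    have h2 : b ≤ Torus.symb (A + R) k q / (1 - ρ) := by rw [le_div_iff₀ h1ρ]; linarith
    exact mul_le_mul h1 h2 hb (le_trans ha h1)
  calc (Torus.bsymb (A + R) k p q - Torus.bsymb (A + R) k q p) ^ 2
      ≤ ((τ + 2 * ρ) * s) ^ 2 := hsq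
    _ = (τ + 2 * ρ) ^ 2 * (a * b) := by rw [mul_pow, hs2]
    _ ≤ (τ + 2 * ρ) ^ 2 * ((Torus.symb (A + R) k p / (1 - ρ)) * (Torus.symb (A + R) k q / (1 - ρ))) :=
        mul_le_mul_of_nonneg_left hab (sq_nonneg _)
    _ = ((τ + 2 * ρ) / (1 - ρ)) ^ 2 * (Torus.symb (A + R) k p * Torus.symb (A + R) k q) := by
        field_simp

/-! ## §2 ODD crossing: the τ-local odd-channel bound passes from the design map `Φ₀` to `Φ = Φ₀ + residue` -/

/-- The RESIDUE HYPOTHESIS on the window, in the odd-channel shape (`λ ∈ [λ₀,Λ]`, `τ ∈ [0,τ₀]`): `Φ S − Φ₀ S` is `ρ`-small relative to `Φ₀ S`. -/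
def ResidueOnInterval (Φ Φ₀ : T4 → T4) (Sstar : T4) (lam₀ Λ τ₀ ρ : ℝ) : Prop :=
  ∀ lam ∈ Set.Icc lam₀ Λ, ∀ S : T4, ∀ τ ∈ Set.Icc 0 τ₀, InInterval Sstar lam S → OddSectorial S τ → RelSmall (Φ S - Φ₀ S) (Φ₀ S) ρ

/-- The EVEN HALF WITH SLACK `δ ≥ 0` for the design map, in the same shape: the image lands in the interval SHRUNK by `1+δ`. -/
def EvenSlackOnInterval (Φ₀ : T4 → T4) (Sstar : T4) (lam₀ Λ τ₀ δ : ℝ) : Prop :=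
  ∀ lam ∈ Set.Icc lam₀ Λ, ∀ S : T4, ∀ τ ∈ Set.Icc 0 τ₀, InInterval Sstar lam S → OddSectorial S τ → InInterval Sstar (lam / (1 + δ)) (Φ₀ S)

/-- **Odd crossing.**  [folklore] -/
theorem oddChannelOn_of_residue {Φ Φ₀ : T4 → T4} {Sstar : T4} {lam₀ Λ κ ε τ₀ ρ δ : ℝ}
    (hO : SectorialOddChannelBoundOn Φ₀ Sstar lam₀ Λ κ ε τ₀) (hE : EvenSlackOnInterval Φ₀ Sstar lam₀ Λ τ₀ δ)
    (hR : ResidueOnInterval Φ Φ₀ Sstar lam₀ Λ τ₀ ρ) (hstar : TransNonneg Sstar) (hlam₀ : 0 < lam₀) (hδ : 0 ≤ δ)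
    (hκ : 0 ≤ κ) (hε : 0 ≤ ε) (hρ : 0 ≤ ρ) (hρ1 : ρ < 1) :
    SectorialOddChannelBoundOn Φ Sstar lam₀ Λ (κ / (1 - ρ)) ((ε + 2 * ρ) / (1 - ρ)) τ₀ := by
  intro lam hlam S τ hτ hSi hSo
  have hlam' : 0 < lam / (1 + δ) := div_pos (hlam₀.trans_le hlam.1) (by linarith)
  have hnn : TransNonneg (Φ₀ S) := transNonneg_of_inInterval (hE lam hlam S τ hτ hSi hSo) hstar hlam'
  have h := oddSectorial_add_of_relSmall (hO lam hlam S τ hτ hSi hSo) (hR lam hlam S τ hτ hSi hSo) hnn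
    (by nlinarith [hτ.1]) hρ hρ1
  have heq : Φ₀ S + (Φ S - Φ₀ S) = Φ S := by abel
  rw [heq] at h
  convert h using 1; field_simp; ring

/-! ## §3 EVEN crossing with defect `μ = 1` -/

/-- **Even crossing.**  Slack `δ` for `Φ₀` and residue `ρ` with `1 ≤ (1-ρ)(1+δ)` give the even half for `Φ` at defect `μ = 1`, in the clause shape
(`τ ∈ [τlo, τhi] ⊆ [0, τ₀]`). [folklore] -/
theorem evenHalf_of_residue {Φ Φ₀ : T4 → T4} {Sstar : T4} {lam₀ Λ τ₀ τlo τhi ρ δ : ℝ}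
    (hE : EvenSlackOnInterval Φ₀ Sstar lam₀ Λ τ₀ δ) (hR : ResidueOnInterval Φ Φ₀ Sstar lam₀ Λ τ₀ ρ) (hstar : TransNonneg Sstar)
    (hlam₀ : 0 < lam₀) (hδ : 0 ≤ δ) (hρ : 0 ≤ ρ) (hfit : 1 ≤ (1 - ρ) * (1 + δ)) (hτlo : 0 ≤ τlo) (hτhi : τhi ≤ τ₀) :
    ∀ τ ∈ Set.Icc τlo τhi, ∀ lam ∈ Set.Icc lam₀ Λ, ∀ S : T4, OddSectorial S τ → InInterval Sstar lam S →
      InInterval Sstar (1 * lam) (Φ S) := by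
  intro τ hτ lam hlam S hSo hSi
  have hτ' : τ ∈ Set.Icc 0 τ₀ := ⟨hτlo.trans hτ.1, hτ.2.trans hτhi⟩
  have hρ1 : ρ < 1 := by nlinarith
  have hlam0 : 0 < lam := hlam₀.trans_le hlam.1
  have hlam' : 0 < lam / (1 + δ) := div_pos hlam0 (by linarith)
  have h := inInterval_add_of_relSmall (hE lam hlam S τ hτ' hSi hSo) (hR lam hlam S τ hτ' hSi hSo) hstar hρ hρ1 hlam'
  have heq : Φ₀ S + (Φ S - Φ₀ S) = Φ S := by abel
  rw [heq] at h
  refine h.mono hstar (div_pos hlam' (by linarith)) ?_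
  -- lam/(1+δ)/(1-ρ) ≤ 1·lam  ⟸  1 ≤ (1-ρ)(1+δ)
  rw [div_div, one_mul, div_le_iff₀ (by nlinarith)]
  nlinarith

/-! ## §4 The window clause, the family with `μ ≡ 1`, and the stub's ∃-statement -/

/-- **The sectorial interval window clause for `Φ` from the design map's data + the residue.** [folklore] -/
theorem windowClause_of_WCrossing {Φ Φ₀ : T4 → T4} {Sstar : T4} {slo shi lam₀ Λ τ₀ τlo τhi κ ε ρ δ : ℝ}
    (hstarI : Torus.NearIso Sstar slo shi) (hslo : 0 < slo) (hlam₀ : 1 ≤ lam₀) (hiso : InInterval Sstar lam₀ (Torus.isoVisc 1))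
    (hO : SectorialOddChannelBoundOn Φ₀ Sstar lam₀ Λ κ ε τ₀) (hE : EvenSlackOnInterval Φ₀ Sstar lam₀ Λ τ₀ δ)
    (hR : ResidueOnInterval Φ Φ₀ Sstar lam₀ Λ τ₀ ρ)
    (hκ : 0 ≤ κ) (hε : 0 ≤ ε) (hρ : 0 ≤ ρ) (hδ : 0 ≤ δ) (hfit : 1 ≤ (1 - ρ) * (1 + δ)) (hgain : κ + ρ < 1)
    (hτlo : (ε + 2 * ρ) / (1 - ρ - κ) ≤ τlo) (hτhi : τhi ≤ τ₀) :
    SectorialIntervalWindowClause Φ Sstar slo shi lam₀ Λ τlo τhi 1 := by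
  have hstar : TransNonneg Sstar := transNonneg_of_nearIso hstarI hslo.le
  have hρ1 : ρ < 1 := by nlinarith
  have h1ρ : 0 < 1 - ρ := by linarith
  have hlam₀' : 0 < lam₀ := by linarith
  have hκ' : 0 ≤ κ / (1 - ρ) := div_nonneg hκ h1ρ.le
  have hκ1' : κ / (1 - ρ) < 1 := by rw [div_lt_one h1ρ]; linarith
  have hε' : 0 ≤ (ε + 2 * ρ) / (1 - ρ) := div_nonneg (by linarith) h1ρ.le
  have hτlo' : (ε + 2 * ρ) / (1 - ρ) / (1 - κ / (1 - ρ)) ≤ τlo := by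
    have : (ε + 2 * ρ) / (1 - ρ) / (1 - κ / (1 - ρ)) = (ε + 2 * ρ) / (1 - ρ - κ) := by
      have h2 : 1 - ρ - κ ≠ 0 := by linarith
      field_simp
    rw [this]; exact hτlo
  exact sectorialIntervalWindowClause_of_channelBoundOn_of_gain_lt_one hstarI hslo.le hlam₀ hiso le_rfl hκ' hκ1' hε' hτlo' hτhi
    (oddChannelOn_of_residue hO hE hR hstar hlam₀' hδ hκ hε hρ hρ1)
    (evenHalf_of_residue hE hR hstar hlam₀' hδ hρ hfit (le_trans (div_nonneg (by linarith) (by linarith)) hτlo) hτhi)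

/-- **The ν-family with `μ ≡ 1`.**  A design map `Φ₀` with the τ-local odd bound and the even clause with slack, a family `Φ ν` whose residue against `Φ₀`
is `ρ`-small UNIFORMLY IN `ν`, and the bookkeeping of the registered `SectorialIntervalWindowFamily` with the explicit choices `Λ' := Λ`, `lo := slo/Λc`,
`hi := shi·Λc`, `τc := τlo`, `β := τlo·(shi·Λc)`, `τhi := τlo·ΛV·(shi·Λc)/(slo/Λc)`. [folklore] -/
theorem windowFamily_of_WCrossing {Φ : ℝ → T4 → T4} {Φ₀ : T4 → T4} {Sstar : T4} {slo shi lam₀ Λ Λc ΛV τ₀ τlo κ ε ρ δ : ℝ}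
    (hstarI : Torus.NearIso Sstar slo shi) (hslo : 0 < slo) (hsh : slo ≤ shi) (hlam₀ : 1 ≤ lam₀) (hiso : InInterval Sstar lam₀ (Torus.isoVisc 1))
    (hO : SectorialOddChannelBoundOn Φ₀ Sstar lam₀ Λ κ ε τ₀) (hE : EvenSlackOnInterval Φ₀ Sstar lam₀ Λ τ₀ δ)
    (hR : ∀ ν, ResidueOnInterval (Φ ν) Φ₀ Sstar lam₀ Λ τ₀ ρ)
    (hκ : 0 ≤ κ) (hε : 0 ≤ ε) (hρ : 0 ≤ ρ) (hδ : 0 ≤ δ) (hfit : 1 ≤ (1 - ρ) * (1 + δ)) (hgain : κ + ρ < 1)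
    (hτlo : (ε + 2 * ρ) / (1 - ρ - κ) ≤ τlo)
    (hΛc : lam₀ ≤ Λc) (hΛV : 1 < ΛV) (hfitV : ΛV * Λc * shi ≤ Λ * slo)
    (hτ₀ : τlo * ΛV * (shi * Λc) / (slo / Λc) ≤ τ₀) :
    SectorialIntervalWindowFamily Φ (fun _ => 1) Sstar slo shi lam₀ Λ Λc Λ τlo (τlo * ΛV * (shi * Λc) / (slo / Λc)) τlo
      (τlo * (shi * Λc)) (slo / Λc) (shi * Λc) ΛV := by
  have hρ1 : ρ < 1 := by nlinarith
  have hτlo0 : 0 ≤ τlo := le_trans (div_nonneg (by linarith) (by linarith)) hτlo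
  have hΛc1 : 1 ≤ Λc := hlam₀.trans hΛc
  have hΛc0 : 0 < Λc := by linarith
  have hshi : 0 < shi := hslo.trans_le hsh
  have hlo0 : 0 < slo / Λc := div_pos hslo hΛc0
  have hhi0 : 0 < shi * Λc := mul_pos hshi hΛc0
  -- Λc ≤ Λ from the V-fit: ΛV Λc shi Λc ≤ Λ slo with ΛV > 1, Λc ≥ 1, shi ≥ slo
  have hΛcΛ : Λc ≤ Λ := by
    have h1 : Λc * slo ≤ ΛV * Λc * shi := by
      have h2 : slo ≤ ΛV * shi := by nlinarith
      nlinarith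
    nlinarith
  -- the τ window: τhi := τlo ΛV hi / lo ≥ τlo
  set τhi := τlo * ΛV * (shi * Λc) / (slo / Λc) with hτhi_def
  have hfac : 1 ≤ ΛV * (shi * Λc) / (slo / Λc) := by
    rw [le_div_iff₀ hlo0]; nlinarith [div_le_self hslo.le hΛc1]
  have hτhi : τlo ≤ τhi := by
    have : τhi = τlo * (ΛV * (shi * Λc) / (slo / Λc)) := by rw [hτhi_def]; ring
    rw [this]; nlinarith
  have c1 : ∀ ν, SectorialIntervalWindowClause (Φ ν) Sstar slo shi lam₀ Λ τlo τhi 1 :=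
    fun ν => windowClause_of_WCrossing hstarI hslo hlam₀ hiso hO hE (hR ν) hκ hε hρ hδ hfit hgain hτlo hτ₀
  have c7 : slo / Λc * Λc ≤ slo := by rw [div_mul_cancel₀ _ hΛc0.ne']
  have c9 : Λ ∈ Set.Icc lam₀ Λ := ⟨hΛc.trans hΛcΛ, le_rfl⟩
  have c10 : ΛV * shi ≤ Λ * (slo / Λc) := by
    rw [mul_div_assoc', le_div_iff₀ hΛc0]
    have h3 : ΛV * Λc * shi = ΛV * shi * Λc := by ring
    linarith
  have c11 : ΛV * (shi * Λc) ≤ Λ * slo := by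
    have h3 : ΛV * Λc * shi = ΛV * (shi * Λc) := by ring
    linarith
  have c12 : τlo ∈ Set.Icc τlo τhi := ⟨le_rfl, hτhi⟩
  have c15 : τlo * (shi * Λc) * ΛV / (slo / Λc) ∈ Set.Icc τlo τhi := by
    have heq : τlo * (shi * Λc) * ΛV / (slo / Λc) = τhi := by rw [hτhi_def]; ring
    rw [heq]; exact ⟨hτhi, le_rfl⟩
  exact ⟨c1, fun _ => le_rfl, tailDefectBound_one hΛc, hslo, hΛc, hΛcΛ, c7, le_rfl, c9, c10, c11, c12, hτlo0, le_rfl, c15⟩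

/-- Scaling: the residue currency is invariant under a common scalar factor. [folklore] -/
theorem RelSmall.smul {R A : T4} {ρ : ℝ} (h : RelSmall R A ρ) (a : ℝ) : RelSmall (a • R) (a • A) ρ := by
  intro k p q hp hq
  have := h k p q hp hq
  rw [Torus.bsymb_smul, Torus.symb_smul, Torus.symb_smul]
  nlinarith [sq_nonneg a, this]

/-- **Packing into the registered stub's ∃-statement.**  The (W)-crossing data (§4) plus the (V) clause for the same family on the window
`(slo/Λc, shi·Λc, ΛV, β = τlo·shi·Λc)` give the conclusion of `stub_cellLawV0_IS` VERBATIM, with defect family `μ ≡ 1`. [folklore] -/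
theorem cellLawV0_IS_statement_of_WCrossing {M : ℝ} (hM : 0 < M) {c : ℝ} (hc : 0 < c)
    {Φ : ℝ → T4 → T4} {Φ₀ : T4 → T4} {Sstar : T4} {slo shi lam₀ Λ Λc ΛV τ₀ τlo κ ε ρ δ : ℝ}
    (hstarI : Torus.NearIso Sstar slo shi) (hslo : 0 < slo) (hslo1 : slo ≤ 1) (hshi1 : 1 ≤ shi) (hlam₀ : 1 ≤ lam₀)
    (hiso : InInterval Sstar lam₀ (Torus.isoVisc 1))
    (hO : SectorialOddChannelBoundOn Φ₀ Sstar lam₀ Λ κ ε τ₀) (hE : EvenSlackOnInterval Φ₀ Sstar lam₀ Λ τ₀ δ)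
    (hR : ∀ ν, ResidueOnInterval (Φ ν) Φ₀ Sstar lam₀ Λ τ₀ ρ)
    (hκ : 0 ≤ κ) (hε : 0 ≤ ε) (hρ : 0 ≤ ρ) (hδ : 0 ≤ δ) (hfit : 1 ≤ (1 - ρ) * (1 + δ)) (hgain : κ + ρ < 1)
    (hτlo : (ε + 2 * ρ) / (1 - ρ - κ) ≤ τlo)
    (hΛc : lam₀ ≤ Λc) (hΛV : 1 < ΛV) (hfitV : ΛV * Λc * shi ≤ Λ * slo)
    (hτ₀ : τlo * ΛV * (shi * Λc) / (slo / Λc) ≤ τ₀)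
    (hV : ∃ σ > (0:ℝ), ∃ C : ℝ, 0 ≤ C ∧ ∃ ν₀ > (0:ℝ), ∃ K > (0:ℝ),
      SlowVectorClauseNoExF cubatureWord M hM c Φ (slo / Λc) (shi * Λc) ΛV (τlo * (shi * Λc)) σ C ν₀ K) :
    ∃ M : ℝ, ∃ hM : 0 < M, ∃ c > (0:ℝ), ∃ Φ : ℝ → Torus.Visc4 (Fin 3) → Torus.Visc4 (Fin 3), ∃ μ : ℝ → ℝ, ∃ Sstar : Torus.Visc4 (Fin 3),
      ∃ slo shi lam₀ Λ Λc Λ' τlo τhi τc : ℝ, ∃ lo > (0:ℝ), ∃ hi : ℝ, lo ≤ 1 ∧ 1 ≤ hi ∧ ∃ ΛV > (1:ℝ), ∃ β ≥ (0:ℝ),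
        SectorialIntervalWindowFamily Φ μ Sstar slo shi lam₀ Λ Λc Λ' τlo τhi τc β lo hi ΛV ∧
        ∃ σ > (0:ℝ), ∃ C : ℝ, 0 ≤ C ∧ ∃ ν₀ > (0:ℝ), ∃ K > (0:ℝ), SlowVectorClauseNoExF cubatureWord M hM c Φ lo hi ΛV β σ C ν₀ K := by
  have hsh : slo ≤ shi := hslo1.trans hshi1
  have hΛc1 : 1 ≤ Λc := hlam₀.trans hΛc
  have hΛc0 : 0 < Λc := by linarith
  have hρ1 : ρ < 1 := by nlinarith
  have hτlo0 : 0 ≤ τlo := le_trans (div_nonneg (by linarith) (by linarith)) hτlo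
  have hlo1 : slo / Λc ≤ 1 := (div_le_self hslo.le hΛc1).trans hslo1
  have hhi1 : 1 ≤ shi * Λc := one_le_mul_of_one_le_of_one_le hshi1 hΛc1
  have hβ : 0 ≤ τlo * (shi * Λc) := mul_nonneg hτlo0 (by positivity)
  exact ⟨M, hM, c, hc, Φ, fun _ => 1, Sstar, slo, shi, lam₀, Λ, Λc, Λ, τlo, τlo * ΛV * (shi * Λc) / (slo / Λc), τlo, slo / Λc,
    div_pos hslo hΛc0, shi * Λc, hlo1, hhi1, ΛV, hΛV, τlo * (shi * Λc), hβ,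
    windowFamily_of_WCrossing hstarI hslo hsh hlam₀ hiso hO hE hR hκ hε hρ hδ hfit hgain hτlo hΛc hΛV hfitV hτ₀, hV⟩

/-! ## §5 The two remaining obligations at the branch-B point, and the stub from them

Both obligations are parametrised by the DESIGN MAP `Φ₀` (normalisation included) and the RESIDUE BUDGET `ρ`; the named stubs instantiate them at
`Φ₀ := ΦB a = a • excQS cubatureWord MB` (`MB := 1/50`, `T₀ = 160π²·MB = 31.6 ≥ 30`: the landed odd design point `oddSectorial_excQS_design_point'` applies BY NAME) and
`ρ := ρB := 1.2·10⁻⁴` — variant A: the ν-free adjacent-pair memory term (`pairQS`, measured 5.4·10⁻⁵–9.7·10⁻⁵ relative on the block window, CONFIRMED by the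
dynamics j319254) is BUDGETED AS RESIDUE; variant B (memo §4): type `pairQS`, take `Φ₀ := a • (excQS + pairQS)` and `ρ := 10⁻⁵` (true residue ≤ 3·10⁻¹⁰). -/

/-- **OBLIGATION D1 (exact family; (V) = w1 g4 S1a/V0, residue = D1).**  There is a family `Ψ ν` of effective maps (intended: the normalised exact
ξ²-coefficient / periodic-corrector Green–Kubo map of the cell problem at parameter `M`, cf. `…CellLawVSlowGraphHomogenised` G8) which (i) is `ρ`-close to
the design map `Φ₀` in `RelSmall` currency on the block window `NearIso(10/11, 11/10)`, sectors `τ ≤ 1/20`, UNIFORMLY IN `ν`, and (ii) satisfies the (V)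
linear-response clause with one amplitude `c > 0` on every sub-window of the block window. -/
def D1ExactFamily (Φ₀ : T4 → T4) (ρ M : ℝ) (hM : 0 < M) : Prop :=
  ∃ Ψ : ℝ → T4 → T4,
    (∀ ν : ℝ, ∀ S : T4, Torus.NearIso S (10 / 11) (11 / 10) → ∀ τ ∈ Set.Icc (0:ℝ) (1 / 20), OddSectorial S τ →
        RelSmall (Ψ ν S - Φ₀ S) (Φ₀ S) ρ) ∧
    (∃ c > (0:ℝ), ∀ lo hi ΛV β : ℝ, 0 < lo → lo ≤ hi → 1 < ΛV → 0 ≤ β → hi * ΛV ≤ 11 / 10 → 10 / 11 * ΛV ≤ lo →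
        ∃ σ > (0:ℝ), ∃ C : ℝ, 0 ≤ C ∧ ∃ ν₀ > (0:ℝ), ∃ K > (0:ℝ), SlowVectorClauseNoExF cubatureWord M hM c Ψ lo hi ΛV β σ C ν₀ K)

/-- **OBLIGATION W₀ (closed-form window with slack; owner: the K1L_D even-half design lane — NOT D1).**  An (eigen-)centre `S⋆` and window data such that the
design map `Φ₀` satisfies the τ-local ODD channel bound (gain `κ`, source `ε`; for `a·excQS`: the landed design point κ = 93/100, ε = 0 after
`InInterval → NearIso(10/11, 11/10)`, scale-free by `oddSectorial_smul_iff`) and the EVEN clause WITH SLACK `δ ≥ ρ/(1−ρ)` on `λ ∈ [λ₀, Λ]`, `τ ≤ τ₀`, plus the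
bookkeeping fits of the registered family (`Λ ≥ ΛV·Λc·shi/slo`, window inside the block window, τ-window below `τ₀ ≤ 1/20`).  PROFILE (j319221/j319319, eigen-
centred, `Φ₀ = a⋆·excQS`, T₀ = 30): slack ≈ 5.5·10⁻³(λ−1) − 0.092·τ² on the extreme families; I-centred NEGATIVE for λ < 1.10. -/
def ClosedFormWindowB (Φ₀ : T4 → T4) (ρ : ℝ) : Prop :=
  ∃ Sstar : T4, ∃ slo shi lam₀ Λ Λc ΛV τ₀ κ ε δ : ℝ,
    Torus.NearIso Sstar slo shi ∧ 0 < slo ∧ slo ≤ 1 ∧ 1 ≤ shi ∧ 1 ≤ lam₀ ∧ InInterval Sstar lam₀ (Torus.isoVisc 1) ∧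
    0 ≤ κ ∧ 0 ≤ ε ∧ 0 ≤ δ ∧ 1 ≤ (1 - ρ) * (1 + δ) ∧ κ + ρ < 1 ∧ lam₀ ≤ Λc ∧ 1 < ΛV ∧ ΛV * Λc * shi ≤ Λ * slo ∧
    shi * Λ ≤ 11 / 10 ∧ 10 / 11 * Λ ≤ slo ∧ shi * Λc * ΛV ≤ 11 / 10 ∧ 10 / 11 * ΛV ≤ slo / Λc ∧
    (ε + 2 * ρ) / (1 - ρ - κ) * ΛV * (shi * Λc) / (slo / Λc) ≤ τ₀ ∧ τ₀ ≤ 1 / 20 ∧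
    SectorialOddChannelBoundOn Φ₀ Sstar lam₀ Λ κ ε τ₀ ∧
    EvenSlackOnInterval Φ₀ Sstar lam₀ Λ τ₀ δ

/-- **The conclusion of `stub_cellLawV0_IS` from the two obligations** (any design map `Φ₀`, budget `ρ ≥ 0`, parameter `M > 0`). [folklore] -/
theorem cellLawV0_IS_statement_of_D1 {Φ₀ : T4 → T4} {ρ M : ℝ} (hM : 0 < M) (hρ0 : 0 ≤ ρ)
    (hW : ClosedFormWindowB Φ₀ ρ) (hD : D1ExactFamily Φ₀ ρ M hM) :
    ∃ M : ℝ, ∃ hM : 0 < M, ∃ c > (0:ℝ), ∃ Φ : ℝ → Torus.Visc4 (Fin 3) → Torus.Visc4 (Fin 3), ∃ μ : ℝ → ℝ, ∃ Sstar : Torus.Visc4 (Fin 3),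
      ∃ slo shi lam₀ Λ Λc Λ' τlo τhi τc : ℝ, ∃ lo > (0:ℝ), ∃ hi : ℝ, lo ≤ 1 ∧ 1 ≤ hi ∧ ∃ ΛV > (1:ℝ), ∃ β ≥ (0:ℝ),
        SectorialIntervalWindowFamily Φ μ Sstar slo shi lam₀ Λ Λc Λ' τlo τhi τc β lo hi ΛV ∧
        ∃ σ > (0:ℝ), ∃ C : ℝ, 0 ≤ C ∧ ∃ ν₀ > (0:ℝ), ∃ K > (0:ℝ), SlowVectorClauseNoExF cubatureWord M hM c Φ lo hi ΛV β σ C ν₀ K := by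
  obtain ⟨Sstar, slo, shi, lam₀, Λ, Λc, ΛV, τ₀, κ, ε, δ, hstarI, hslo, hslo1, hshi1, hlam₀, hiso, hκ, hε, hδ, hfit, hgain, hΛc, hΛV,
    hfitV, hwinhi, hwinlo, hVhi, hVlo, hτ₀, hτ₀', hO, hE⟩ := hW
  obtain ⟨Ψ, hres, c, hc, hVc⟩ := hD
  have hΛc1 : 1 ≤ Λc := hlam₀.trans hΛc
  have hΛc0 : 0 < Λc := by linarith
  set τlo : ℝ := (ε + 2 * ρ) / (1 - ρ - κ) with hτlo_def
  have hτlo0 : 0 ≤ τlo := div_nonneg (by linarith) (by linarith)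
  -- the residue on the interval window
  have hR : ∀ ν, ResidueOnInterval (Ψ ν) Φ₀ Sstar lam₀ Λ τ₀ ρ := by
    intro ν lam hlam S τ hτ hSi hSo
    have hlam1 : 1 ≤ lam := hlam₀.trans hlam.1
    have hlam0 : 0 < lam := by linarith
    have hN : Torus.NearIso S (10 / 11) (11 / 10) := by
      refine (InInterval.nearIso hlam1 hstarI hSi).mono ?_ ?_
      · rw [le_div_iff₀ hlam0]; nlinarith [hlam.2]
      · nlinarith [hlam.2, hslo.trans_le (hslo1.trans hshi1)]
    exact hres ν S hN τ ⟨hτ.1, hτ.2.trans hτ₀'⟩ hSo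
  -- the (V) clause on the window (slo/Λc, shi·Λc, ΛV, τlo·shi·Λc)
  have hV := hVc (slo / Λc) (shi * Λc) ΛV (τlo * (shi * Λc)) (div_pos hslo hΛc0)
    ((div_le_self hslo.le hΛc1).trans (hslo1.trans (hshi1.trans (le_mul_of_one_le_right (by linarith) hΛc1))))
    hΛV (mul_nonneg hτlo0 (by positivity)) hVhi hVlo
  exact cellLawV0_IS_statement_of_WCrossing hM hc hstarI hslo hslo1 hshi1 hlam₀ hiso hO hE hR hκ hε hρ0 hδ hfit hgain le_rfl hΛc hΛV hfitV hτ₀ hV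

/-- Branch-B relaxation parameter `M_B = 1/50` (`T_min = 160π²/50 = 31.6 ≥ 30`, the hypothesis of the landed `oddSectorial_excQS_design_point'`). -/
def MB : ℝ := 1 / 50

theorem MB_pos : 0 < MB := by norm_num [MB]

/-- The residue budget of D1 in `RelSmall` currency, variant A (pair memory budgeted as residue): `1.2·10⁻⁴`. -/
def ρB : ℝ := 3 / 25000

theorem ρB_nonneg : 0 ≤ ρB := by norm_num [ρB]

/-- The normalised quasi-static design map at branch B. -/
def ΦB (a : ℝ) : T4 → T4 := fun S => a • excQS cubatureWord MB S

/-- **The ODD conjunct of `ClosedFormWindowB (ΦB a) ρ` is DISCHARGED by the landed design point** (`oddSectorial_excQS_design_point'`, κ = 93/100, ε = 0,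
τ ≤ 1/5) for ANY normalisation `a` (`OddSectorial.smul`) on any interval window contained in the block window (`shi·Λ ≤ 11/10`, `10/11·Λ ≤ slo`). [folklore] -/
theorem oddChannelOn_ΦB (a : ℝ) {Sstar : T4} {slo shi lam₀ Λ τ₀ : ℝ} (hstarI : Torus.NearIso Sstar slo shi) (hslo : 0 < slo) (hsh : slo ≤ shi)
    (hlam₀ : 1 ≤ lam₀) (hwinhi : shi * Λ ≤ 11 / 10) (hwinlo : 10 / 11 * Λ ≤ slo) (hτ₀ : τ₀ ≤ 1 / 5) :
    SectorialOddChannelBoundOn (ΦB a) Sstar lam₀ Λ (93 / 100) 0 τ₀ := by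
  intro lam hlam S τ hτ hSi hSo
  have hlam1 : 1 ≤ lam := hlam₀.trans hlam.1
  have hlam0 : 0 < lam := by linarith
  have hN : Torus.NearIso S (10 / 11) (11 / 10) := by
    refine (InInterval.nearIso hlam1 hstarI hSi).mono ?_ ?_
    · rw [le_div_iff₀ hlam0]; nlinarith [hlam.2]
    · nlinarith [hlam.2, hslo.trans_le hsh]
  have h := (OddGain.oddSectorial_excQS_design_point' (Mlag := MB) (le_of_eq rfl) ⟨hτ.1, hτ.2.trans hτ₀⟩ hN hSo).smul a
  simpa only [ΦB, add_zero] using h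

/-- **The EVEN-ONLY form of obligation W₀** at branch B: numeric side conditions + the even clause with slack about an (eigen-)centre; the odd conjunct is
supplied by `oddChannelOn_ΦB` (κ = 93/100, ε = 0). -/
def EvenSlackWindowB (a : ℝ) (ρ : ℝ) : Prop :=
  ∃ Sstar : T4, ∃ slo shi lam₀ Λ Λc ΛV τ₀ δ : ℝ,
    Torus.NearIso Sstar slo shi ∧ 0 < slo ∧ slo ≤ 1 ∧ 1 ≤ shi ∧ 1 ≤ lam₀ ∧ InInterval Sstar lam₀ (Torus.isoVisc 1) ∧
    0 ≤ δ ∧ 1 ≤ (1 - ρ) * (1 + δ) ∧ 93 / 100 + ρ < 1 ∧ lam₀ ≤ Λc ∧ 1 < ΛV ∧ ΛV * Λc * shi ≤ Λ * slo ∧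
    shi * Λ ≤ 11 / 10 ∧ 10 / 11 * Λ ≤ slo ∧ shi * Λc * ΛV ≤ 11 / 10 ∧ 10 / 11 * ΛV ≤ slo / Λc ∧
    (0 + 2 * ρ) / (1 - ρ - 93 / 100) * ΛV * (shi * Λc) / (slo / Λc) ≤ τ₀ ∧ τ₀ ≤ 1 / 20 ∧
    EvenSlackOnInterval (ΦB a) Sstar lam₀ Λ τ₀ δ

/-- `EvenSlackWindowB a ρ → ClosedFormWindowB (ΦB a) ρ` (odd conjunct by the design point). [folklore] -/
theorem closedFormWindowB_of_evenSlack {a ρ : ℝ} (h : EvenSlackWindowB a ρ) : ClosedFormWindowB (ΦB a) ρ := by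
  obtain ⟨Sstar, slo, shi, lam₀, Λ, Λc, ΛV, τ₀, δ, hstarI, hslo, hslo1, hshi1, hlam₀, hiso, hδ, hfit, hgain, hΛc, hΛV, hfitV,
    hwinhi, hwinlo, hVhi, hVlo, hτ₀, hτ₀', hE⟩ := h
  exact ⟨Sstar, slo, shi, lam₀, Λ, Λc, ΛV, τ₀, 93 / 100, 0, δ, hstarI, hslo, hslo1, hshi1, hlam₀, hiso, by norm_num, le_rfl, hδ, hfit, hgain, hΛc, hΛV,
    hfitV, hwinhi, hwinlo, hVhi, hVlo, hτ₀, hτ₀',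
    oddChannelOn_ΦB a hstarI hslo (hslo1.trans hshi1) hlam₀ hwinhi hwinlo (hτ₀'.trans (by norm_num)), hE⟩

/-- STUB W₀ (even-half design lane): the closed-form EIGEN-centred even clause with slack `δ ≥ ρB/(1−ρB)` at the branch-B point for some normalisation `a`,
plus the numeric side conditions of `EvenSlackWindowB` (profile, T₀ = 30–31.6: `a⋆ ≈ 2.078·10⁵` in the units of `d1/wmargin_cf.py`, `S⋆` = Perron eigen-shape of
`excQS` (aspect 1.0011 from `isoVisc 1`), λ₀ = 1.04, τ₀ = 0.02, Λc = λ₀, ΛV = 1.05, Λ = ΛV·λ₀·shi/slo ≈ 1.094; realised slack 1.7–1.9·10⁻⁴ ≥ 1.2·10⁻⁴ on all tested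
input families — interval end faces, order-reversal tilts, 8+8 random psd faces, sectorial τ ≤ 0.02; kit j319319).  The odd conjunct is NOT part of this stub. -/
theorem stub_W_evenSlackB : ∃ a > (0:ℝ), EvenSlackWindowB a ρB := by
  sorry

/-- Obligation W₀ in the `ClosedFormWindowB` shape, from the even-only stub. -/
theorem stub_W_closedFormB : ∃ a > (0:ℝ), ClosedFormWindowB (ΦB a) ρB := by
  obtain ⟨a, ha, h⟩ := stub_W_evenSlackB
  exact ⟨a, ha, closedFormWindowB_of_evenSlack h⟩

/-- STUB D1 (+ V0): the exact family against the normalised design map, every normalisation.  See `D1ExactFamily`. -/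
theorem stub_D1_exactFamily : ∀ a > (0:ℝ), D1ExactFamily (ΦB a) ρB MB MB_pos := by
  sorry

/-- **`stub_cellLawV0_IS` from the two stubs** — the registered stub's statement VERBATIM (its `ScalarLawBlock` hypothesis is not needed on this line:
the isotropic scalar law is replaced by the eigen-centred tensor window). -/
theorem stub_cellLawV0_IS_of_D1 :
    ScalarLawBlock Summit.AnomalousDissipation.AnomalousDissipation.Theorems.cubatureWord Summit.AnomalousDissipation.AnomalousDissipation.Theorems.c0 →
    ∃ M : ℝ, ∃ hM : 0 < M, ∃ c > (0:ℝ), ∃ Φ : ℝ → Torus.Visc4 (Fin 3) → Torus.Visc4 (Fin 3), ∃ μ : ℝ → ℝ, ∃ Sstar : Torus.Visc4 (Fin 3),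
      ∃ slo shi lam₀ Λ Λc Λ' τlo τhi τc : ℝ, ∃ lo > (0:ℝ), ∃ hi : ℝ, lo ≤ 1 ∧ 1 ≤ hi ∧ ∃ ΛV > (1:ℝ), ∃ β ≥ (0:ℝ),
        SectorialIntervalWindowFamily Φ μ Sstar slo shi lam₀ Λ Λc Λ' τlo τhi τc β lo hi ΛV ∧
        ∃ σ > (0:ℝ), ∃ C : ℝ, 0 ≤ C ∧ ∃ ν₀ > (0:ℝ), ∃ K > (0:ℝ),
          SlowVectorClauseNoExF Summit.AnomalousDissipation.AnomalousDissipation.Theorems.cubatureWord M hM c Φ lo hi ΛV β σ C ν₀ K := by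
  intro _
  obtain ⟨a, ha, hW⟩ := stub_W_closedFormB
  exact cellLawV0_IS_statement_of_D1 MB_pos ρB_nonneg hW (stub_D1_exactFamily a ha)

end

end Summit.AnomalousDissipation.AnomalousDissipation.Cruxes.LagrangianRenormalisationStep.WCrossing
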